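import Literature.NumberTheory.Automorphic.Zelevinsky1980.InducedMaximalParabolicEndomorphisms
import Literature.NumberTheory.Automorphic.OpenCellCoinvariants
import HarnessLib

/-!
# The unit shell of `Ind_B^{GL₂} σ'` and its symmetry under `w₀` (irregular rank-two case, part 1)

Topic `NumberTheory/Automorphic/Zelevinsky1980`; theorems only (no definition, no named fact). Let `F` be
a non-archimedean local field, `B = Q_{1,1} = standardParabolicGL F (lastBlockLabel 2)` the upper Borel
subgroup of `GL₂(F)` (the case `N = 2`, `n = 0` of the sibling files `MaximalParabolic*`,
`JacquetOfInducedMaximalParabolic`, `InducedMaximalParabolicEndomorphisms`), `w₀ = permGL Fin.revPerm`,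
`N' = oppositeCellRadical (lastBlockLabel 2) = {n(x) = 1 + x E₀₁}` (`≅ F`, the coordinate of the open cell
`B w₀ N'`), and `σ'` a smooth one-dimensional representation of `B` (on `ℂ`).

* §1 `GL₂` identities: `w₀² = 1` and, for `y ≠ 0`,
  `w₀ n(y) w₀ = (diag(-y⁻¹, y) n(-y)) · w₀ · n(y⁻¹)` (`permGL_mul_transvection_mul_permGL`) — the
  change of chart between the two vertices of the open cell;
* §2 `N' ⊆ U_c` and `U₂ = U_c` for the Borel (`mem_unipotentRadicalGL_of_mem_oppositeCellRadical_two`,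
  `mem_unipotentRadicalGL_of_mem_upperUnitriangular_two`); `σ'(p) ≠ 0` (`apply_one_ne_zero`);
* §3 for the UNIT BOX `K₀ = {n(x) : |x| ≤ 1}` and the LEVEL-ONE BOX `K₁ = {n(x) : |x| ≤ |ϖ|}` of `N'`
  (compact open subgroups given through their membership criteria) and the standard sections
  `Φ₀ = Φ_{K₀,1}`, `Φ₁ = Φ_{K₁,1}` (`cellSection`, `OpenCellSections`):
  `toFun_sub_cellSection_unitShell` — `(Φ₀ - Φ₁)(p w₀ n(x)) = σ'(p) · [|x| = 1]` (the unit shell), and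
  **`smoothIndRep_permGL_sub_cellSection_unitShell`** — if `σ'` is trivial on `U_c` and its two torus
  characters AGREE ON UNITS (`σ'(diag(u, 1)) = σ'(diag(1, u))` for `|u| = 1`), then
  `w₀ · (Φ₀ - Φ₁) = σ'(diag(-1, 1)) · (Φ₀ - Φ₁)`: the unit shell is an EIGENVECTOR of `w₀`
  (`w₀ n(y) w₀ ∈ B w₀ n(y⁻¹)` exchanges the shell with itself, and `σ'(diag(-y⁻¹, y)) = σ'(diag(-1,1))`
  for `|y| = 1` by the hypothesis).

This is the input of the companion file `RankTwoInducedEndomorphismsIrregular`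
(`End_{GL₂}(Ind_B^{GL₂} σ') = ℂ` when the torus characters agree on units — the case `χ × χ` of
[Zelevinsky1980, Thm. 4.2] for `GL₂`, where the two exponents of the Jacquet module COINCIDE and the
exponent separation of `InducedMaximalParabolicEndomorphisms` does not apply; Bernstein–Zelevinsky 1977,
Thm. 5.2 / §7.1 for the pair `(B, B)`: the non-split extension of `σ'` by `σ'` in `(Ind σ')_U`). No Haar
measure is used. Written for the cell `hodgecm-mathlib` (row IV-3 (b), irregular rank-two case).

## References

* I. N. Bernstein, A. V. Zelevinsky, *Induced representations of reductive `p`-adic groups I*,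
  Ann. Sci. ÉNS 10 (1977), Thm. 5.2, §7.1. [BernsteinZelevinskyASENS1977]
* A. V. Zelevinsky, *Induced representations of reductive `p`-adic groups II*, Ann. Sci. ÉNS 13
  (1980), §1, Thm. 4.2. [Zelevinsky1980]
* D. Bump, *Automorphic Forms and Representations* (1997), Thm. 4.5.1–4.5.3 (the `GL₂` principal
  series `χ₁ = χ₂`). [Bump1997]
-/

noncomputable section

open Matrix Literature.LinearAlgebra.Matrix.DiagonalTorus

namespace Literature.NumberTheory.Automorphic.Zelevinsky1980

open ValuativeRel Valued

/-! ### 1. Two `GL₂` identities -/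

section MatrixIdentities

variable {F : Type*} [Field F]

/-- Entries of the permutation matrix `w₀ = P_{rev}` of `GL₂`: `(w₀)_{ij} = [i ≠ j]`. [folklore] -/
private theorem coe_permGL_revPerm_two_apply (i j : Fin 2) :
    ((permGL Fin.revPerm : GL (Fin 2) F) : Matrix (Fin 2) (Fin 2) F) i j = if i = j then 0 else 1 := by
  rw [coe_permGL, permMatrix_apply']
  fin_cases i <;> fin_cases j <;> rfl

/-- `w₀² = 1` in `GL₂`. [folklore] -/
private theorem permGL_revPerm_two_mul_self :
    (permGL Fin.revPerm : GL (Fin 2) F) * permGL Fin.revPerm = 1 := by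
  apply Units.ext
  ext i j
  rw [Units.val_mul, Matrix.mul_apply, Fin.sum_univ_two, Units.val_one]
  simp only [coe_permGL_revPerm_two_apply]
  fin_cases i <;> fin_cases j <;> simp

/-- **The `GL₂` identity behind the open-cell chart at the other vertex**: for `y ≠ 0`,
`w₀ n(y) w₀ = (diag(-y⁻¹, y) n(-y)) · w₀ · n(y⁻¹)`, with `n(β) = 1 + β E₀₁`. [folklore] -/
private theorem permGL_mul_transvection_mul_permGL {y : F} (hy : y ≠ 0) {ny nyi nny : GL (Fin 2) F}
    (hny : (ny : Matrix (Fin 2) (Fin 2) F) = Matrix.transvection 0 1 y)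
    (hnyi : (nyi : Matrix (Fin 2) (Fin 2) F) = Matrix.transvection 0 1 y⁻¹)
    (hnny : (nny : Matrix (Fin 2) (Fin 2) F) = Matrix.transvection 0 1 (-y)) :
    permGL Fin.revPerm * ny * permGL Fin.revPerm =
      diagGL (Fin 2) ![-(Units.mk0 y hy)⁻¹, Units.mk0 y hy] * nny * permGL Fin.revPerm * nyi := by
  apply Units.ext
  ext i j
  simp only [Units.val_mul, val_diagGL, hny, hnyi, hnny]
  fin_cases i <;> fin_cases j <;>
    simp [Matrix.mul_apply, Fin.sum_univ_two, coe_permGL_revPerm_two_apply, Matrix.transvection,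
      Matrix.single_apply, hy]

end MatrixIdentities

/-! ### 2. `GL₂` in the labelling `lastBlockLabel 2`: `N' ⊆ U_c`, the unit box and its transversal -/

section RankTwo

variable {F : Type*} [Field F]

/-- A non-zero element of `Fin 2` is `1`. [folklore] -/
private theorem fin_two_eq_one_of_ne_zero {j : Fin 2} (hj : j ≠ 0) : j = 1 := by
  fin_cases j
  · exact absurd rfl hj
  · rfl

/-- For `GL₂`, the elements of `N' = oppositeCellRadical (lastBlockLabel 2)` are the transvections
`1 + x₀₁ E₀₁`; in particular they lie in the unipotent radical `U_c` of the Borel `Q_{1,1}`.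
[cite: BernsteinZelevinskyASENS1977, §7.1] -/
theorem mem_unipotentRadicalGL_of_mem_oppositeCellRadical_two {x : GL (Fin 2) F}
    (hx : x ∈ oppositeCellRadical (K := F) (lastBlockLabel 2)) :
    x ∈ unipotentRadicalGL F (lastBlockLabel 2) := by
  obtain ⟨e, heN, heU, hmat⟩ := exists_transvection_mem (n := 0) ((x : Matrix (Fin 2) (Fin 2) F) 0 1)
  have hxe : x = e := by
    refine eq_of_mem_oppositeCellRadical_of_apply_zero_eq hx heN fun j hj => ?_
    rw [fin_two_eq_one_of_ne_zero hj, hmat]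
    simp [Matrix.transvection]
  rw [hxe]
  exact heU

/-- For `GL₂`, the upper unitriangular group `U₂` is the unipotent radical `U_c` of `Q_{1,1}`.
[cite: BernsteinZelevinskyASENS1977, §7.1] -/
theorem mem_unipotentRadicalGL_of_mem_upperUnitriangular_two {u : GL (Fin 2) F}
    (hu : u ∈ upperUnitriangular (Fin 2) F) : u ∈ unipotentRadicalGL F (lastBlockLabel 2) := by
  rw [upperUnitriangular, mem_unipotentRadicalGL_iff_apply] at hu
  rw [mem_unipotentRadicalGL_iff_apply]
  intro i j hij
  refine hu i j ?_
  fin_cases i <;> fin_cases j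
  · exact le_rfl
  · exact absurd hij (by decide)
  · exact Fin.zero_le _
  · exact le_rfl

variable [ValuativeRel F] [TopologicalSpace F] [IsNonarchimedeanLocalField F]
  (σ' : Representation ℂ ↥(standardParabolicGL F (lastBlockLabel 2)) ℂ)

omit [ValuativeRel F] [TopologicalSpace F] [IsNonarchimedeanLocalField F] in
/-- The scalar by which a one-dimensional `σ'` acts is non-zero (a one-dimensional representation is a
character). [cite: Zelevinsky1980, §3.2 Example] -/
theorem apply_one_ne_zero (p : ↥(standardParabolicGL F (lastBlockLabel 2))) : σ' p 1 ≠ 0 := by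
  intro h
  have h1 : σ' p⁻¹ (σ' p 1) = 1 := by
    rw [← Module.End.mul_apply, ← map_mul, inv_mul_cancel, MonoidHom.map_one]
    rfl
  rw [h, map_zero] at h1
  exact zero_ne_one h1

/-! ### 3. The unit shell `Φ_{K₀,1} - Φ_{K₁,1}` and its symmetry under `w₀` -/

/-- **The unit shell.** For the unit box `K₀ = {n(x) : |x| ≤ 1}` and the level-one box
`K₁ = {n(x) : |x| ≤ |ϖ|}` of `N' ≅ F` (given by their membership criteria), the difference of standard
sections `Φ_{K₀,1} - Φ_{K₁,1}` takes at `p w₀ n(x)` the value `σ'(p)` if `|x| = 1` and `0` otherwise.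
[cite: BernsteinZelevinskyASENS1977, §7.1] -/
theorem toFun_sub_cellSection_unitShell (hσ' : σ'.IsSmooth) {ϖ : F} (hϖ : IsUniformizingElement ϖ)
    {K₀ K₁ : Subgroup ↥(oppositeCellRadical (K := F) (lastBlockLabel 2))}
    (hK₀o : IsOpen (K₀ : Set ↥(oppositeCellRadical (K := F) (lastBlockLabel 2))))
    (hK₀c : IsCompact (K₀ : Set ↥(oppositeCellRadical (K := F) (lastBlockLabel 2))))
    (hK₁o : IsOpen (K₁ : Set ↥(oppositeCellRadical (K := F) (lastBlockLabel 2))))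
    (hK₁c : IsCompact (K₁ : Set ↥(oppositeCellRadical (K := F) (lastBlockLabel 2))))
    (memK₀ : ∀ x : ↥(oppositeCellRadical (K := F) (lastBlockLabel 2)), x ∈ K₀ ↔
      valuation F (((x : GL (Fin 2) F) : Matrix (Fin 2) (Fin 2) F) 0 1) ≤ 1)
    (memK₁ : ∀ x : ↥(oppositeCellRadical (K := F) (lastBlockLabel 2)), x ∈ K₁ ↔
      valuation F (((x : GL (Fin 2) F) : Matrix (Fin 2) (Fin 2) F) 0 1) ≤ valuation F ϖ)
    {p : GL (Fin 2) F} (hp : p ∈ standardParabolicGL F (lastBlockLabel 2)) (x : ↥(oppositeCellRadical (K := F) (lastBlockLabel 2))) :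
    (cellSection σ' (monotone_lastBlockLabel 2) hσ' K₀ hK₀o hK₀c (1 : ℂ) -
        cellSection σ' (monotone_lastBlockLabel 2) hσ' K₁ hK₁o hK₁c (1 : ℂ)).toFun (p * permGL Fin.revPerm * (x : GL (Fin 2) F)) =
      if valuation F (((x : GL (Fin 2) F) : Matrix (Fin 2) (Fin 2) F) 0 1) = 1 then σ' ⟨p, hp⟩ 1
      else 0 := by
  classical
  have hc : Monotone (lastBlockLabel 2) := monotone_lastBlockLabel 2
  have hvϖ1 : valuation F ϖ < 1 := hϖ.valuation_lt_one
  have hK₁K₀ : K₁ ≤ K₀ := fun x hx => by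
    rw [memK₀]; rw [memK₁] at hx; exact hx.trans hvϖ1.le
  set Φ₀ := cellSection σ' (monotone_lastBlockLabel 2) hσ' K₀ hK₀o hK₀c (1 : ℂ) with hΦ₀def
  set Φ₁ := cellSection σ' (monotone_lastBlockLabel 2) hσ' K₁ hK₁o hK₁c (1 : ℂ) with hΦ₁def
  show (Φ₀ - Φ₁).toFun _ = _

  have e : (Φ₀ - Φ₁).toFun = Φ₀.toFun - Φ₁.toFun := by
    rw [← Representation.SmoothInd.toFunₗ_apply, map_sub, Representation.SmoothInd.toFunₗ_apply,
      Representation.SmoothInd.toFunₗ_apply]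
  rw [e, Pi.sub_apply, hΦ₀def, hΦ₁def, toFun_cellSection, toFun_cellSection]
  have hx0 : valuation F (((x : GL (Fin 2) F) : Matrix (Fin 2) (Fin 2) F) 0 1) ≤ 1 →
      ¬ valuation F (((x : GL (Fin 2) F) : Matrix (Fin 2) (Fin 2) F) 0 1) ≤ valuation F ϖ →
      valuation F (((x : GL (Fin 2) F) : Matrix (Fin 2) (Fin 2) F) 0 1) = 1 := by
    intro h1 h2
    refine le_antisymm h1 (not_lt.1 fun h3 => h2 ((valuation_lt_one_iff_le_valuation hϖ _).1 h3))
  by_cases h0 : x ∈ K₀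
  · rw [cellSectionFun_eq_of_mem hc (1 : ℂ) hp x.2 h0]
    by_cases h1 : x ∈ K₁
    · rw [cellSectionFun_eq_of_mem hc (1 : ℂ) hp x.2 h1, sub_self, if_neg]
      rw [memK₁] at h1
      exact fun h => (lt_irrefl _) ((h ▸ h1).trans_lt hvϖ1)
    · rw [cellSectionFun_eq_zero_of_not_mem hc (1 : ℂ) hp x.2 h1, sub_zero, if_pos]
      exact hx0 ((memK₀ x).1 h0) (fun h => h1 ((memK₁ x).2 h))
  · rw [cellSectionFun_eq_zero_of_not_mem hc (1 : ℂ) hp x.2 h0,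
      cellSectionFun_eq_zero_of_not_mem hc (1 : ℂ) hp x.2 (fun h => h0 (hK₁K₀ h)), sub_zero, if_neg]
    exact fun h => h0 ((memK₀ x).2 h.le)

/-- **`Φ_{K₀,1} - Φ_{K₁,1}` is an eigenvector of `w₀`** with eigenvalue `σ'(diag(-1, 1))`, provided
`σ'` is trivial on `U_c` and its two torus characters agree on units (`σ'(diag(u,1)) = σ'(diag(1,u))`,
`|u| = 1`): on the open cell, `w₀ n(y) w₀ = (diag(-y⁻¹, y) n(-y)) w₀ n(y⁻¹)` exchanges the unit shell
with itself. This is the rank-two identity replacing exponent separation in the irregular case.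
[cite: BernsteinZelevinskyASENS1977, Thm. 5.2 and §7.1] -/
theorem smoothIndRep_permGL_sub_cellSection_unitShell
    (hU : ∀ u : ↥(standardParabolicGL F (lastBlockLabel 2)), u ∈ unipotentRadicalP F (lastBlockLabel 2) → σ' u = 1)
    (hH : ∀ u : Fˣ, valuation F (u : F) = 1 →
      σ' ⟨diagGL (Fin 2) (Function.update 1 0 u), diagGL_mem_standardParabolicGL _ _⟩ 1 =
        σ' ⟨diagGL (Fin 2) (Function.update 1 (Fin.last 1) u), diagGL_mem_standardParabolicGL _ _⟩ 1)
    (hσ' : σ'.IsSmooth) {ϖ : F} (hϖ : IsUniformizingElement ϖ)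
    {K₀ K₁ : Subgroup ↥(oppositeCellRadical (K := F) (lastBlockLabel 2))}
    (hK₀o : IsOpen (K₀ : Set ↥(oppositeCellRadical (K := F) (lastBlockLabel 2))))
    (hK₀c : IsCompact (K₀ : Set ↥(oppositeCellRadical (K := F) (lastBlockLabel 2))))
    (hK₁o : IsOpen (K₁ : Set ↥(oppositeCellRadical (K := F) (lastBlockLabel 2))))
    (hK₁c : IsCompact (K₁ : Set ↥(oppositeCellRadical (K := F) (lastBlockLabel 2))))
    (memK₀ : ∀ x : ↥(oppositeCellRadical (K := F) (lastBlockLabel 2)), x ∈ K₀ ↔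
      valuation F (((x : GL (Fin 2) F) : Matrix (Fin 2) (Fin 2) F) 0 1) ≤ 1)
    (memK₁ : ∀ x : ↥(oppositeCellRadical (K := F) (lastBlockLabel 2)), x ∈ K₁ ↔
      valuation F (((x : GL (Fin 2) F) : Matrix (Fin 2) (Fin 2) F) 0 1) ≤ valuation F ϖ) :
    Representation.smoothIndRep (standardParabolicGL F (lastBlockLabel 2)) σ' (permGL Fin.revPerm)
        (cellSection σ' (monotone_lastBlockLabel 2) hσ' K₀ hK₀o hK₀c (1 : ℂ) -
          cellSection σ' (monotone_lastBlockLabel 2) hσ' K₁ hK₁o hK₁c (1 : ℂ)) =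
      σ' ⟨diagGL (Fin 2) ![-1, 1], diagGL_mem_standardParabolicGL _ _⟩ 1 •
        (cellSection σ' (monotone_lastBlockLabel 2) hσ' K₀ hK₀o hK₀c (1 : ℂ) -
          cellSection σ' (monotone_lastBlockLabel 2) hσ' K₁ hK₁o hK₁c (1 : ℂ)) := by
  classical
  have hc : Monotone (lastBlockLabel 2) := monotone_lastBlockLabel 2
  have hvϖ1 : valuation F ϖ < 1 := hϖ.valuation_lt_one
  have hK₁K₀ : K₁ ≤ K₀ := fun x hx => by
    rw [memK₀]; rw [memK₁] at hx; exact hx.trans hvϖ1.le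
  set Φ₀ := cellSection σ' (monotone_lastBlockLabel 2) hσ' K₀ hK₀o hK₀c (1 : ℂ) with hΦ₀def
  set Φ₁ := cellSection σ' (monotone_lastBlockLabel 2) hσ' K₁ hK₁o hK₁c (1 : ℂ) with hΦ₁def
  have hUP : unipotentRadicalGL F (lastBlockLabel 2) ≤ standardParabolicGL F (lastBlockLabel 2) := unipotentRadicalGL_le F _
  have hσU : ∀ {u : GL (Fin 2) F} (hu : u ∈ unipotentRadicalGL F (lastBlockLabel 2)),
      σ' ⟨u, hUP hu⟩ = 1 := fun {u} hu => hU ⟨u, hUP hu⟩ (by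
        rw [← unipotentRadicalGL_subgroupOf, Subgroup.mem_subgroupOf]; exact hu)
  have hshell : ∀ {p : GL (Fin 2) F} (hp : p ∈ standardParabolicGL F (lastBlockLabel 2)) (x : ↥(oppositeCellRadical (K := F) (lastBlockLabel 2))),
      (Φ₀ - Φ₁).toFun (p * permGL Fin.revPerm * (x : GL (Fin 2) F)) =
        if valuation F (((x : GL (Fin 2) F) : Matrix (Fin 2) (Fin 2) F) 0 1) = 1 then σ' ⟨p, hp⟩ 1
        else 0 := fun hp x =>
    toFun_sub_cellSection_unitShell σ' hσ' hϖ hK₀o hK₀c hK₁o hK₁c memK₀ memK₁ hp x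
  have hκP : diagGL (Fin 2) ![-1, 1] ∈ standardParabolicGL F (lastBlockLabel 2) := diagGL_mem_standardParabolicGL _ _
  show Representation.smoothIndRep (standardParabolicGL F (lastBlockLabel 2)) σ' (permGL Fin.revPerm) (Φ₀ - Φ₁) =
    σ' ⟨diagGL (Fin 2) ![-1, 1], hκP⟩ 1 • (Φ₀ - Φ₁)

  apply Representation.SmoothInd.ext
  funext g
  rw [Representation.toFun_smoothIndRep_apply, Representation.SmoothInd.toFun_smul, Pi.smul_apply,
    smul_eq_mul]
  by_cases hg : g ∈ parabolicDoubleCoset (K := F) (lastBlockLabel 2) Fin.revPerm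
  · obtain ⟨p, hp, n', hn', rfl⟩ := (mem_parabolicDoubleCoset_rev_iff (lastBlockLabel 2) hc g).1 hg
    set y : F := (n' : Matrix (Fin 2) (Fin 2) F) 0 1 with hy
    rw [hshell hp ⟨n', hn'⟩]
    by_cases hy0 : y = 0
    · -- `n' = 1`: both sides vanish
      have hn'1 : n' = 1 := by
        refine eq_of_mem_oppositeCellRadical_of_apply_zero_eq hn' (Subgroup.one_mem _) fun j hj => ?_
        rw [fin_two_eq_one_of_ne_zero hj, Units.val_one, Matrix.one_apply_ne zero_ne_one]
        exact hy0
      have hpcell : p ∉ parabolicDoubleCoset (K := F) (lastBlockLabel 2) Fin.revPerm := by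
        rw [mem_parabolicDoubleCoset_rev_iff_apply_ne_zero, not_not]
        exact (mem_standardParabolicGL_lastBlockLabel_iff p).1 hp 0 (by decide)
      rw [if_neg (by change ¬ valuation F y = 1; rw [hy0, map_zero]; exact zero_ne_one), mul_zero,
        hn'1, mul_one, mul_assoc, permGL_revPerm_two_mul_self, mul_one]
      have e : (Φ₀ - Φ₁).toFun = Φ₀.toFun - Φ₁.toFun := by
        rw [← Representation.SmoothInd.toFunₗ_apply, map_sub, Representation.SmoothInd.toFunₗ_apply,
          Representation.SmoothInd.toFunₗ_apply]
      rw [e, Pi.sub_apply, hΦ₀def, hΦ₁def, toFun_cellSection, toFun_cellSection,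
        cellSectionFun_of_not_mem hc _ _ hpcell, cellSectionFun_of_not_mem hc _ _ hpcell, sub_zero]
    · -- `n' = n(y)`, `y ≠ 0`: `p w₀ n(y) w₀ = (p D n(-y)) w₀ n(y⁻¹)`
      obtain ⟨nyi, hnyiN, -, hnyimat⟩ := exists_transvection_mem (F := F) (n := 0) y⁻¹
      obtain ⟨nny, hnnyN, hnnyU, hnnymat⟩ := exists_transvection_mem (F := F) (n := 0) (-y)
      have hn'mat : (n' : Matrix (Fin 2) (Fin 2) F) = Matrix.transvection 0 1 y := by
        obtain ⟨ny, hnyN, -, hnymat⟩ := exists_transvection_mem (F := F) (n := 0) y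
        have : n' = ny := by
          refine eq_of_mem_oppositeCellRadical_of_apply_zero_eq hn' hnyN fun j hj => ?_
          rw [fin_two_eq_one_of_ne_zero hj, hnymat]
          simp [Matrix.transvection, hy]
        rw [this]; exact hnymat
      have key := permGL_mul_transvection_mul_permGL hy0 hn'mat hnyimat hnnymat
      set D : GL (Fin 2) F := diagGL (Fin 2) ![-(Units.mk0 y hy0)⁻¹, Units.mk0 y hy0] with hDdef
      have hDP : D ∈ standardParabolicGL F (lastBlockLabel 2) := diagGL_mem_standardParabolicGL _ _
      have hpD : p * D * nny ∈ standardParabolicGL F (lastBlockLabel 2) := Subgroup.mul_mem _ (Subgroup.mul_mem _ hp hDP) (hUP hnnyU)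
      have e2 : p * permGL Fin.revPerm * n' * permGL Fin.revPerm =
          (p * D * nny) * permGL Fin.revPerm * nyi := by
        rw [mul_assoc p, mul_assoc p, key]; group
      rw [e2, hshell hpD ⟨nyi, hnyiN⟩]
      have hvyi : valuation F ((nyi : Matrix (Fin 2) (Fin 2) F) 0 1) = (valuation F y)⁻¹ := by
        rw [hnyimat]; simp [Matrix.transvection]
      simp only [hvyi, inv_eq_one]
      by_cases hvy : valuation F y = 1
      · rw [if_pos hvy, if_pos hvy]
        -- `σ'(p D n(-y)) = σ'(p) σ'(D)` and `σ'(D) = σ'(diag(-1,1))` on the unit shell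
        have hyu : valuation F ((Units.mk0 y hy0 : Fˣ) : F) = 1 := hvy
        have hDfac : D = diagGL (Fin 2) ![-1, 1] *
            ((diagGL (Fin 2) (Function.update 1 0 (Units.mk0 y hy0)))⁻¹ *
              diagGL (Fin 2) (Function.update 1 (Fin.last 1) (Units.mk0 y hy0))) := by
          rw [hDdef, ← map_inv, ← map_mul, ← map_mul]
          congr 1
          funext i
          fin_cases i <;> simp [Function.update, Fin.last]
        have hHy : σ' ⟨(diagGL (Fin 2) (Function.update 1 0 (Units.mk0 y hy0)))⁻¹ *
            diagGL (Fin 2) (Function.update 1 (Fin.last 1) (Units.mk0 y hy0)),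
            Subgroup.mul_mem _ (Subgroup.inv_mem _ (diagGL_mem_standardParabolicGL _ _))
              (diagGL_mem_standardParabolicGL _ _)⟩ (1 : ℂ) = 1 := by
          have hmul : (⟨(diagGL (Fin 2) (Function.update 1 0 (Units.mk0 y hy0)))⁻¹ *
              diagGL (Fin 2) (Function.update 1 (Fin.last 1) (Units.mk0 y hy0)),
              Subgroup.mul_mem _ (Subgroup.inv_mem _ (diagGL_mem_standardParabolicGL _ _))
                (diagGL_mem_standardParabolicGL _ _)⟩ : ↥(standardParabolicGL F (lastBlockLabel 2))) =
              (⟨diagGL (Fin 2) (Function.update 1 0 (Units.mk0 y hy0)), diagGL_mem_standardParabolicGL _ _⟩ :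
                ↥(standardParabolicGL F (lastBlockLabel 2)))⁻¹ *
              ⟨diagGL (Fin 2) (Function.update 1 (Fin.last 1) (Units.mk0 y hy0)),
                diagGL_mem_standardParabolicGL _ _⟩ := rfl
          rw [hmul, map_mul, Module.End.mul_apply, ← hH _ hyu, ← Module.End.mul_apply, ← map_mul,
            inv_mul_cancel, MonoidHom.map_one]
          rfl
        have e3 : (⟨p * D * nny, hpD⟩ : ↥(standardParabolicGL F (lastBlockLabel 2))) =
            ⟨p, hp⟩ * ((⟨diagGL (Fin 2) ![-1, 1], hκP⟩ : ↥(standardParabolicGL F (lastBlockLabel 2))) *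
              ⟨(diagGL (Fin 2) (Function.update 1 0 (Units.mk0 y hy0)))⁻¹ *
                diagGL (Fin 2) (Function.update 1 (Fin.last 1) (Units.mk0 y hy0)),
                Subgroup.mul_mem _ (Subgroup.inv_mem _ (diagGL_mem_standardParabolicGL _ _))
                  (diagGL_mem_standardParabolicGL _ _)⟩) * ⟨nny, hUP hnnyU⟩ := by
          apply Subtype.ext
          change p * D * nny = p * (diagGL (Fin 2) ![-1, 1] * _) * nny
          rw [← hDfac]
        rw [e3, map_mul, map_mul, map_mul, hσU hnnyU, mul_one, Module.End.mul_apply,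
          Module.End.mul_apply, hHy, apply_eq_mul_apply_one σ' ⟨p, hp⟩, mul_comm]
      · rw [if_neg hvy, if_neg hvy, mul_zero]
  · -- off the open cell: `g ∈ P`, both sides vanish
    have hgP : g ∈ standardParabolicGL F (lastBlockLabel 2) := by
      rw [mem_parabolicDoubleCoset_rev_iff_apply_ne_zero, not_not] at hg
      rw [mem_standardParabolicGL_lastBlockLabel_iff]
      intro j hj
      have : j = 0 := by
        fin_cases j
        · rfl
        · exact absurd rfl hj
      rw [this]; exact hg
    have e : (Φ₀ - Φ₁).toFun = Φ₀.toFun - Φ₁.toFun := by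
      rw [← Representation.SmoothInd.toFunₗ_apply, map_sub, Representation.SmoothInd.toFunₗ_apply,
        Representation.SmoothInd.toFunₗ_apply]
    have h1 : (Φ₀ - Φ₁).toFun (g * permGL Fin.revPerm) = 0 := by
      have := hshell hgP (1 : ↥(oppositeCellRadical (K := F) (lastBlockLabel 2)))
      rw [OneMemClass.coe_one, mul_one] at this
      rw [this, if_neg]
      rw [Units.val_one, Matrix.one_apply_ne zero_ne_one, map_zero]; exact zero_ne_one
    rw [h1, e, Pi.sub_apply, hΦ₀def, hΦ₁def, toFun_cellSection, toFun_cellSection,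
      cellSectionFun_of_not_mem hc _ _ hg, cellSectionFun_of_not_mem hc _ _ hg, sub_zero, mul_zero]

end RankTwo

end Literature.NumberTheory.Automorphic.Zelevinsky1980
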